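import Summits.BirchSwinnertonDyer.BirchSwinnertonDyer.Theorems.PrintCFramBottomClassIndexLawFiveLeBorelOrderTelescope
import HarnessLib

/-!
# Route `PrintCFram`, crux C2 `BottomClassIndexLawFiveLe` (stmt-BirchSwinnertonDyer-20372), line
# `eisenstein-resource-bdp-line` (registry v18), Kolyvagin lane: **KOLYVAGIN'S ORDER TELESCOPE UNDER A DEFECTIVE
# ČEBOTAREV AXIOM, II — THE LEDGER `Σ Nᵢ ≤ M₀ + K·(Δ1+Δ(−1))`, THE BRIDGE «REQUEST ⟹ KERNEL WITH DEFECT», AND THE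
# `𝓞`-DEPTH CURRENCY** (sequel of `…BorelOrderTelescope`; cell `bsd-print-cfram`, seat `bsd-line-cfram-p1-w2` g8;
# helper `--supports` 20372; 0 defs, 0 facts, 0 sorry)

HONEST FRAMING. Nothing about BSD is proved here and nothing of any stub; pure algebra. File I
(`…BorelOrderTelescope.exists_chain_of_casselsTate_defect`) runs McCallum's chain (Thm. 5.4) with a kernel-form
Čebotarev carrying a defect `Δ ν` on classes of sign `ν` and proves the invariant
(I_Δ) `p^i c(n_k) ∈ ⟨s_j : j > k⟩ ⟹ (M − M₀) + Σ_{j≤k} expo s_j ≤ i + k·(Δ1+Δ(−1))`. This file draws the conclusions: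

* §1 **`sum_expo_le_M₀_add_of_casselsTate_defect`** — at `k = K`, `p^M c(n_K) = 0 ∈ ⟨∅⟩`: **`Σ_{i≤K} expo sᵢ ≤
  M₀ + K·(Δ1+Δ(−1))`**. For `Δ ≡ 0` this is the tree's `HypothesesM.sum_expo_le_M₀_of_casselsTate` verbatim (in
  explicit currency); under the Borel rule (`Δ η_line = 0`, `Δ (−η_line) = 1`; w2 g7 FILE 7′) it is `Σ Nᵢ ≤ M₀ + K`,
  i.e. for the lifts of a maximal isotropic `D = ⊕_{i≤K} Dᵢ` of `Ш(W/K″)[p^∞]`: **`ord_p #Ш(W/K″)[p^∞] = 2·Σ Nᵢ ≤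
  2M₀ + 2K`** — Kolyvagin's ORDER bound survives the Borel prime with at most one `p` of slack per step of the
  alternating chain (`K ≤ 2·max(g⁺, g⁻)`, `g^±` the number of cyclic factors of `D^±`), and is McCallum's `2M₀`
  verbatim whenever each step's `(−η)`-member (the lift `s_{k+1}` at odd steps, the Kolyvagin class `c(n_k)` at even
  steps, on the visible model `η = ε`) is faithfully localised — by FILE 7′, whenever its `T`-reduced representative
  has EVEN `𝓞`-depth: the one-parity residue w2 g7 isolated for Claim B (notes §3), now once per step.
* §2 `kernelDefect_of_request(_of_mem_closure)` — the bridge REQUEST ⟹ KERNEL-WITH-DEFECT on one cyclic line: if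
  `⟨T⟩ ⊆ ker loc_λ` and some representative `g* = g − t*` (`t* ∈ ⟨T⟩`), killed by `p^{N*}`, has
  `p^{N*−Δ−1} g* ∉ ker loc_λ` (local order `≥ ord/p^Δ`), then `p^i g ∈ ker loc_λ ⟹ p^{i+Δ} g ∈ ⟨T⟩`. So `hCebΔ` is met
  by FILE 7′ (`…BorelRequestsCebotarev.exists_kolyvaginPrime_gt_pow_requests_of_cmRamified`: `η`-classes any order
  `≤ ord`, `(−η)`-classes `≤ p^{⌊e/2⌋}`, any member `↦ 0`) applied to the family (`g₁*`, `g₂*`, `T`) once its tops are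
  independent — which a top-layer reduction of the later lifts arranges (successor task, companion note).
* §3 `sum_half_succ_dp_le_M₀_add_of_casselsTate_defect` — §1 in the `𝓞`-depth currency of `…BorelDescentClaimA`
  (`p^a v = 0 ↔ dp v ≤ 2a`, `ord v = p^{⌈dp v/2⌉}`): `Σ (dp sᵢ + 1)/2 ≤ M₀ + K·(Δ1+Δ(−1))`.

READING (numbers, not adjectives). The exponent era of this lane (w2 g5–g7) ends at `p^{2M₀+1}·Sel ⊆ ℤx`; the order
era starts at `2M₀ + 2K`, and the whole sharpness residue is ONE DEPTH PARITY PER STEP of the chain. THEOREMS ONLY; no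
definition, no named fact, no `sorry`. BSD is not proved by any of this; no summit statement is proved by this seat.
References: [McCallumLMS1991] §1 Theorem, §3 Prop. 3.1/Cor. 3.2, §4 Prop. 4.7, §5 Lemma 5.3, Thm. 5.4, Cor. 5.6.
-/

set_option autoImplicit false
-- `…BirchSwinnertonDyer.BirchSwinnertonDyer.Theorems…` is the problem's mandated namespace (D-0017).
set_option linter.dupNamespace false

noncomputable section

open scoped Classical

namespace Summit.BirchSwinnertonDyer.BirchSwinnertonDyer.Theorems.PrintCFram.BorelDescent

open Literature.NumberTheory.EllipticCurves Literature.NumberTheory.EllipticCurves.KolyvaginDescent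
  Summit.BirchSwinnertonDyer.BirchSwinnertonDyer.Theorems.SylvesterTwoUpper.DescentDefect

/-! ## §1 Kolyvagin's inequality with a defect ledger: `Σ Nᵢ ≤ M₀ + K·(Δ1 + Δ(−1))` -/

section Ledger

variable {V : Type*} [AddCommGroup V] {Pl : Type*}
variable {p M M₀ M₁ : ℕ} {ε : ℤ} {τ : V →+ V} {Sel : AddSubgroup V} {Loc : Pl → AddSubgroup V}
  {Kol : ℕ → Prop} {pl : ℕ → Pl} {A : ℕ → AddSubgroup V} {x : V} {c : ℕ → V}
  {expo : V → ℕ} {Δ : ℤ → ℕ}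

/-- **Kolyvagin's order telescope under a defective kernel-form Čebotarev: `Σᵢ expo sᵢ ≤ M₀ + K·(Δ1 + Δ(−1))`.**
(McCallum 1991 §1 Theorem with Thm. 5.4 "≤" and Cor. 5.6, telescope form; the tree's
`HypothesesM.sum_expo_le_M₀_of_casselsTate` is the case `Δ ≡ 0`.) For the lifts `s₁,…,s_K` of the generators of a
maximal isotropic `D = ⊕ Dᵢ` of `Ш_{p^∞} = Sel/ℤx` (alternating signs, `x`-independent, pairwise isotropic) this is
`Σ Nᵢ ≤ M₀ + K·(Δ1+Δ(−1))`, i.e. `#Ш_{p^∞} = (#D)² ≤ p^{2M₀ + 2K(Δ1+Δ(−1))}`; under the Borel rule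
(`Δ η = 0`, `Δ (−η) = 1`) **`ord_p #Ш ≤ 2M₀ + 2K`** — one `p` of slack per step of the alternating chain.
[cite: McCallumLMS1991, §1 Theorem; Thm. 5.4 (proof), Cor. 5.6; Prop. 3.1, Prop. 4.7, Lemma 5.3] -/
theorem sum_expo_le_M₀_add_of_casselsTate_defect (hp : p.Prime) (hε : ε = 1 ∨ ε = -1)
    (htor : ∀ v : V, ((p : ℤ) ^ M) • v = 0)
    (hexpo : ∀ (v : V) (a : ℕ), ((p : ℤ) ^ a) • v = 0 ↔ expo v ≤ a)
    (hKol : ∀ ℓ, Kol ℓ → ℓ.Prime) (hSel : ∀ s, s ∈ Sel ↔ ∀ v, s ∈ Loc v)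
    (hxord : ((p : ℤ) ^ (M - 1)) • x ≠ 0) (hc1 : c 1 = ((p : ℤ) ^ M₀) • x)
    (hτc : ∀ n, KolSupp Kol n → τ (c n) = (ε * (-1) ^ n.primeFactors.card) • c n)
    (hc44 : ∀ ℓ m, Kol ℓ → KolSupp Kol (ℓ * m) → ∀ a : ℕ,
      (((p : ℤ) ^ a) • c (ℓ * m) ∈ Loc (pl ℓ)) ↔ ((p : ℤ) ^ a) • c m ∈ A ℓ)
    {R : Type*} [AddCommGroup R] (P : Sel →+ Sel →+ R)
    (hCTV : ∀ ℓ m : ℕ, Kol ℓ → KolSupp Kol (ℓ * m) → ¬ ℓ ∣ m →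
      ∀ (j N a b : ℕ) (t : V) (ht : t ∈ Sel) (hz : ((p : ℤ) ^ j) • c (ℓ * m) ∈ Sel),
      ((p : ℤ) ^ N) • t = 0 → τ t = (ε * (-1) ^ (ℓ * m).primeFactors.card) • t →
      (∀ q ∈ m.primeFactors, t ∈ A q) → M - M₁ ≤ j → N + M₁ ≤ M → N ≤ j → a + b + 1 = N →
      ((p : ℤ) ^ (a + (j - N))) • c m ∉ A ℓ → ((p : ℤ) ^ b) • t ∉ A ℓ →
      P ⟨_, hz⟩ ⟨t, ht⟩ ≠ 0)
    (hCebΔ : ∀ (T : Finset V) (g₁ g₂ : V) (ν : ℤ), (ν = 1 ∨ ν = -1) → τ g₁ = ν • g₁ →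
      τ g₂ = (-ν) • g₂ → (∀ t ∈ T, ∃ e : ℤ, (e = 1 ∨ e = -1) ∧ τ t = e • t) → ∀ b : ℕ,
      ∃ ℓ, b < ℓ ∧ Kol ℓ ∧ (∀ t ∈ T, t ∈ A ℓ) ∧
        (∀ i : ℕ, ((p : ℤ) ^ i) • g₁ ∈ A ℓ →
          ((p : ℤ) ^ (i + Δ ν)) • g₁ ∈ AddSubgroup.closure (T : Set V)) ∧
        (∀ i : ℕ, ((p : ℤ) ^ i) • g₂ ∈ A ℓ →
          ((p : ℤ) ^ (i + Δ (-ν))) • g₂ ∈ AddSubgroup.closure (T : Set V)))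
    (K : ℕ) (s : ℕ → V) (hsel : ∀ i, s i ∈ Sel)
    (hτs : ∀ i ∈ Finset.Ioc 0 K, τ (s i) = (ε * (-1) ^ i) • s i)
    (hiso : ∀ i ∈ Finset.Ioc 0 K, ∀ i' ∈ Finset.Ioc 0 K, P ⟨s i, hsel i⟩ ⟨s i', hsel i'⟩ = 0)
    (hind : ∀ (b : ℤ) (a : ℕ → ℤ), b • x + ∑ i ∈ Finset.Ioc 0 K, a i • s i = 0 →
      b • x = 0 ∧ ∀ i ∈ Finset.Ioc 0 K, a i • s i = 0)
    (hM₁ : M₀ + K * (Δ 1 + Δ (-1)) ≤ M₁) (hroom : ∀ i ∈ Finset.Ioc 0 K, expo (s i) + M₁ ≤ M) :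
    ∑ i ∈ Finset.Ioc 0 K, expo (s i) ≤ M₀ + K * (Δ 1 + Δ (-1)) := by
  obtain ⟨n, -, -, -, hI⟩ := exists_chain_of_casselsTate_defect hp hε htor hexpo hKol hSel hxord hc1 hτc
    hc44 P hCTV hCebΔ K s hsel hτs hiso hind hM₁ hroom K le_rfl
  have := hI M (by rw [htor]; exact zero_mem _)
  omega

end Ledger

/-! ## §2 Request ⟹ kernel-with-defect on one cyclic line (the bridge to FILE 7′) -/

section Bridge

variable {V : Type*} [AddCommGroup V] {p : ℕ}

/-- **Request ⟹ kernel form with defect, one cyclic line.** If the later lifts `T` die at `λ` (`⟨T⟩ ≤ A`) and some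
representative `g* = g − t*`, `t* ∈ ⟨T⟩`, killed by `p^{N*}`, has local order at least `p^{N*−Δ}` at `λ`
(`N* − Δ − 1 < N* − Δ ⟹ p^{N*−Δ−1} g* ∉ A`, vacuous when `N* ≤ Δ`), then `p^i g ∈ A ⟹ p^{i+Δ} g ∈ ⟨T⟩`. This is
how the hypothesis `hCebΔ` of §1 is met from a REQUEST-form Čebotarev (FILE 7′ `…BorelRequestsCebotarev`, which
grants orders `≤ ord` to `η`-classes and `≤ ord/p` to odd-depth `(−η)`-classes) applied to a `T`-reduced representative.
[cite: McCallumLMS1991, §3 Prop. 3.1, Cor. 3.2] -/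
theorem kernelDefect_of_request {A H : AddSubgroup V} (hTA : H ≤ A) {g t : V} (ht : t ∈ H) {Ns Δ : ℕ}
    (hkill : ((p : ℤ) ^ Ns) • (g - t) = 0)
    (hvis : Δ < Ns → ((p : ℤ) ^ (Ns - Δ - 1)) • (g - t) ∉ A)
    {i : ℕ} (hi : ((p : ℤ) ^ i) • g ∈ A) : ((p : ℤ) ^ (i + Δ)) • g ∈ H := by
  -- `p^i g* ∈ A`
  have hgi : ((p : ℤ) ^ i) • (g - t) ∈ A := by
    rw [smul_sub]
    exact A.sub_mem hi (hTA (H.zsmul_mem ht _))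
  -- hence `Ns - Δ ≤ i`
  have hle : Ns ≤ i + Δ := by
    by_contra hlt
    push Not at hlt
    exact hvis (by omega) (pow_zsmul_mem_of_le (show i ≤ Ns - Δ - 1 by omega) hgi)
  -- so `p^{i+Δ} g* = 0` and `p^{i+Δ} g = p^{i+Δ} t* ∈ ⟨T⟩`
  have h0 : ((p : ℤ) ^ (i + Δ)) • (g - t) = 0 := pow_zsmul_eq_zero_of_le hle hkill
  rw [smul_sub, sub_eq_zero] at h0
  rw [h0]
  exact H.zsmul_mem ht _

/-- The same with `H = ⟨T⟩` for a finite set `T` of classes dying at `λ`. [folklore] -/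
theorem kernelDefect_of_request_of_mem_closure {A : AddSubgroup V} {T : Finset V} (hTA : ∀ t ∈ T, t ∈ A)
    {g t : V} (ht : t ∈ AddSubgroup.closure (T : Set V)) {Ns Δ : ℕ}
    (hkill : ((p : ℤ) ^ Ns) • (g - t) = 0)
    (hvis : Δ < Ns → ((p : ℤ) ^ (Ns - Δ - 1)) • (g - t) ∉ A)
    {i : ℕ} (hi : ((p : ℤ) ^ i) • g ∈ A) :
    ((p : ℤ) ^ (i + Δ)) • g ∈ AddSubgroup.closure (T : Set V) :=
  kernelDefect_of_request ((AddSubgroup.closure_le _).mpr fun t ht ↦ hTA t ht) ht hkill hvis hi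

end Bridge

/-! ## §3 The telescope in the `𝓞`-depth currency of `…BorelDescentClaimA` -/

section Depth

variable {V : Type*} [AddCommGroup V] {Pl : Type*}
variable {p M M₀ M₁ : ℕ} {ε : ℤ} {τ : V →+ V} {Sel : AddSubgroup V} {Loc : Pl → AddSubgroup V}
  {Kol : ℕ → Prop} {pl : ℕ → Pl} {A : ℕ → AddSubgroup V} {x : V} {c : ℕ → V}
  {dp : V → ℕ} {Δ : ℤ → ℕ}

/-- An `𝓞`-depth function (`p^a v = 0 ↔ dp v ≤ 2a`) yields the exact-exponent function `⌈dp v/2⌉`. [folklore] -/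
theorem pow_zsmul_eq_zero_iff_half_succ_le
    (hdp : ∀ (v : V) (a : ℕ), ((p : ℤ) ^ a) • v = 0 ↔ dp v ≤ 2 * a) (v : V) (a : ℕ) :
    ((p : ℤ) ^ a) • v = 0 ↔ (dp v + 1) / 2 ≤ a := by
  rw [hdp]
  omega

/-- **The order telescope in depth currency: `Σᵢ ⌈dp sᵢ/2⌉ ≤ M₀ + K·(Δ1 + Δ(−1))`** (`ord sᵢ = p^{⌈dp sᵢ/2⌉}`).
Under the Borel rule `Δ η_line = 0`, `Δ (−η_line) = 1` this is `Σ Nᵢ ≤ M₀ + K`.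
[cite: McCallumLMS1991, §1 Theorem; Thm. 5.4, Cor. 5.6] -/
theorem sum_half_succ_dp_le_M₀_add_of_casselsTate_defect (hp : p.Prime) (hε : ε = 1 ∨ ε = -1)
    (htor : ∀ v : V, ((p : ℤ) ^ M) • v = 0)
    (hdp : ∀ (v : V) (a : ℕ), ((p : ℤ) ^ a) • v = 0 ↔ dp v ≤ 2 * a)
    (hKol : ∀ ℓ, Kol ℓ → ℓ.Prime) (hSel : ∀ s, s ∈ Sel ↔ ∀ v, s ∈ Loc v)
    (hxord : ((p : ℤ) ^ (M - 1)) • x ≠ 0) (hc1 : c 1 = ((p : ℤ) ^ M₀) • x)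
    (hτc : ∀ n, KolSupp Kol n → τ (c n) = (ε * (-1) ^ n.primeFactors.card) • c n)
    (hc44 : ∀ ℓ m, Kol ℓ → KolSupp Kol (ℓ * m) → ∀ a : ℕ,
      (((p : ℤ) ^ a) • c (ℓ * m) ∈ Loc (pl ℓ)) ↔ ((p : ℤ) ^ a) • c m ∈ A ℓ)
    {R : Type*} [AddCommGroup R] (P : Sel →+ Sel →+ R)
    (hCTV : ∀ ℓ m : ℕ, Kol ℓ → KolSupp Kol (ℓ * m) → ¬ ℓ ∣ m →
      ∀ (j N a b : ℕ) (t : V) (ht : t ∈ Sel) (hz : ((p : ℤ) ^ j) • c (ℓ * m) ∈ Sel),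
      ((p : ℤ) ^ N) • t = 0 → τ t = (ε * (-1) ^ (ℓ * m).primeFactors.card) • t →
      (∀ q ∈ m.primeFactors, t ∈ A q) → M - M₁ ≤ j → N + M₁ ≤ M → N ≤ j → a + b + 1 = N →
      ((p : ℤ) ^ (a + (j - N))) • c m ∉ A ℓ → ((p : ℤ) ^ b) • t ∉ A ℓ →
      P ⟨_, hz⟩ ⟨t, ht⟩ ≠ 0)
    (hCebΔ : ∀ (T : Finset V) (g₁ g₂ : V) (ν : ℤ), (ν = 1 ∨ ν = -1) → τ g₁ = ν • g₁ →
      τ g₂ = (-ν) • g₂ → (∀ t ∈ T, ∃ e : ℤ, (e = 1 ∨ e = -1) ∧ τ t = e • t) → ∀ b : ℕ,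
      ∃ ℓ, b < ℓ ∧ Kol ℓ ∧ (∀ t ∈ T, t ∈ A ℓ) ∧
        (∀ i : ℕ, ((p : ℤ) ^ i) • g₁ ∈ A ℓ →
          ((p : ℤ) ^ (i + Δ ν)) • g₁ ∈ AddSubgroup.closure (T : Set V)) ∧
        (∀ i : ℕ, ((p : ℤ) ^ i) • g₂ ∈ A ℓ →
          ((p : ℤ) ^ (i + Δ (-ν))) • g₂ ∈ AddSubgroup.closure (T : Set V)))
    (K : ℕ) (s : ℕ → V) (hsel : ∀ i, s i ∈ Sel)
    (hτs : ∀ i ∈ Finset.Ioc 0 K, τ (s i) = (ε * (-1) ^ i) • s i)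
    (hiso : ∀ i ∈ Finset.Ioc 0 K, ∀ i' ∈ Finset.Ioc 0 K, P ⟨s i, hsel i⟩ ⟨s i', hsel i'⟩ = 0)
    (hind : ∀ (b : ℤ) (a : ℕ → ℤ), b • x + ∑ i ∈ Finset.Ioc 0 K, a i • s i = 0 →
      b • x = 0 ∧ ∀ i ∈ Finset.Ioc 0 K, a i • s i = 0)
    (hM₁ : M₀ + K * (Δ 1 + Δ (-1)) ≤ M₁)
    (hroom : ∀ i ∈ Finset.Ioc 0 K, (dp (s i) + 1) / 2 + M₁ ≤ M) :
    ∑ i ∈ Finset.Ioc 0 K, (dp (s i) + 1) / 2 ≤ M₀ + K * (Δ 1 + Δ (-1)) :=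
  sum_expo_le_M₀_add_of_casselsTate_defect (expo := fun v ↦ (dp v + 1) / 2) hp hε htor
    (pow_zsmul_eq_zero_iff_half_succ_le hdp) hKol hSel hxord hc1 hτc hc44 P hCTV hCebΔ K s hsel hτs hiso
    hind hM₁ hroom

end Depth

end Summit.BirchSwinnertonDyer.BirchSwinnertonDyer.Theorems.PrintCFram.BorelDescent

end
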